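import Literature.AlgebraicGeometry.HodgeTheory.BettiHodgeConjectureFourfoldProductsHodgeNumbers
import Literature.AlgebraicGeometry.HodgeTheory.HodgeConjectureProductsThreefoldsSmallChowZero
import Literature.AlgebraicGeometry.HodgeTheory.BettiHodgeConjectureSquareOffMiddleAlgebraic
import Literature.AlgebraicGeometry.Motives.FanoRationallyChainConnected
import HarnessLib

/-!
# `HC(F × F')` for two FOURFOLDS by coniveau and pure pieces; unconditionally for `CH₀(F)`, `CH₀(F')` supported on surfaces with `h^{2,0}(F') = h^{3,1}(F') = 0` (e.g. two Fano fourfolds, one with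
# `h^{3,1} = 0`, granted Kollár–Miyaoka–Mori), and the self-product `F × F`
# (Bloch–Srinivas 1983 Thm. 1; Voisin II Thm. 10.17, Cor. 10.18/10.21, Prop. 10.26; Voisin 2013 Lemma 2.1; Conte–Murre 1978 Thm. 1; Voisin I §11.3.3 Thm. 11.38–11.40, Lemma 11.41, pp. 285–287, Thm. 11.30; KMM92 Thm. 3.3)

Family `hodge`, lane `lit-hodgefound` (Track 2 foundations library; Layers A1/A4), layer `Literature/AlgebraicGeometry/HodgeTheory`.  THEOREMS ONLY (no definition, no named fact, no instance;
D-0026 net debt `0`).  Sequel of the seat's g33-#5 (`BettiHodgeConjectureFourfoldProductsConiveau`: `F × C`, `F × S`, `F × T`; «`HC(F × F')` NOT claimed (the piece `H⁴ ⊗ H'⁴`)»).  Here `F × F'`: the reduced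
window has SEVEN pieces — `H¹ ⊗ H'³`, `H² ⊗ H'²`, `H³ ⊗ H'¹ ⊂ H⁴`; `H² ⊗ H'⁴`, `H³ ⊗ H'³`, `H⁴ ⊗ H'² ⊂ H⁶`; `H⁴ ⊗ H'⁴ ⊂ H⁸`.  The three pieces with an `H³`-factor are algebraic by coniveau as soon as
`N¹H³(F) = H³(F)` and `N¹H³(F') = H³(F')` (Voisin 2013 Lemma 2.1 on the tree's carriers, `c − 1 ≤ r + s`, `N⁰ = everything`); the four even pieces drop out when one factor consists of Hodge classes
all of which are algebraic (the tree's `…_of_hodgeClasses_eq_top_left/right` with `HC(F)`, `HC(F')`): `h^{2,0}(F)h^{2,0}(F') = 0`; [`h^{2,0}(F) = 0` or `Hdg²(H⁴F') = H⁴(F';ℚ)`]; [`Hdg²(H⁴F) = H⁴(F;ℚ)` or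
`h^{2,0}(F') = 0`]; [`Hdg²(H⁴F) = ⊤` or `Hdg²(H⁴F') = ⊤`] (§1).  When `CH₀(F)` and `CH₀(F')` are supported on surfaces, Bloch–Srinivas supplies `HC(F)`, `HC(F')` (the tree's
`hodgeConjectureFor_four_of_hasChowZeroSupportedInDimLE`), `N¹Hˡ = Hˡ` for `l ≥ 3` on both (so `h^{4,0} = 0` and `Hdg²(H⁴F') = ⊤ ⟺ h^{3,1}(F') = 0`, the seat's g33-#2 `BettiUniverse.hodgeClasses_hodge_four_eq_top_iff`),
and all four bracketed clauses hold once `h^{2,0}(F') = h^{3,1}(F') = 0`: **`HC(F × F')` for every fourfold `F` with `CH₀` on a surface and every fourfold `F'` with `CH₀` on a surface and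
`h^{2,0}(F') = h^{3,1}(F') = 0`** — e.g. `F'` with `CH₀` on a curve and `h^{3,1} = 0`; two Fano fourfolds one of which has `h^{3,1} = 0` (granted KMM); the self-product of a fourfold with `CH₀` on a
surface and `h^{2,0} = h^{3,1} = 0` (§2).  (A smooth cubic fourfold has `h^{3,1} = 1`: products of cubic fourfolds are NOT covered — the piece `H⁴ ⊗ H'⁴` then carries K3-type Hodge classes.)

WHAT IS PROVED.
* §1 **`BettiUniverse.hodgeConjectureFor_tensor_fourfolds_of_supportedClasses_three_eq_top`** (`HC(F)`, `HC(F')`, `N¹H³` on both, and the four even-piece clauses ⟹ `HC(F × F')`).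
* §2 **`BettiUniverse.hodgeNumber_four_zero_eq_zero_of_supportedClasses_four_one_eq_top`** (`N¹H⁴(X) = H⁴(X) ⟹ h^{4,0} = 0`), **`hodgeConjectureFor_tensor_fourfolds_of_hasChowZeroSupportedInDimLE_two`**
  (`CH₀` on surfaces twice, `h^{2,0}(F') = h^{3,1}(F') = 0`; no instance / Hodge-model / `HC` hypothesis beyond the two Hodge numbers), **`…_two_one`** (`CH₀(F')` on a curve, `h^{3,1}(F') = 0`),
  **`hodgeConjectureFor_tensor_fourfolds_of_isFano`** (granted `KollarMiyaokaMori1992_fano_rationallyChainConnected`, `h^{3,1}(F') = 0`), **`hodgeConjectureFor_tensor_self_fourfold_of_hasChowZeroSupportedInDimLE_two`**.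

THE PRINTS.  S. Bloch, V. Srinivas (1983) [BlochSrinivas1983] Thm. 1.  C. Voisin (2003) [VoisinHodgeII2003] §10.2.2 Thm. 10.17, Cor. 10.18, Cor. 10.21; §10.2.3 Prop. 10.26.  C. Voisin (2013) [Voisin2013GHCBloch] Lemma 2.1
(proof).  A. Conte, J. P. Murre (1978) [ConteMurre1978] Thm. 1.  C. Voisin (2002) [VoisinHodgeI2002] §7.1.1; §11.3.1 Thm. 11.30; §11.3.3 Thm. 11.38–11.40, Lemma 11.41, pp. 285–287.  J. Kollár, Y. Miyaoka, S. Mori (1992)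
[KollarMiyaokaMori1992] Thm. 3.3.  P. Deligne (2000/2006) [Deligne2000] §1.

THE OBJECTS (all the tree's).  `BettiUniverse.kunnethSummand`, `BettiUniverse.crossMap`, `BettiUniverse.hodge`, `HodgeStructure.hodgeNumber`, `hodgeClasses`, `supportedClasses`, `algebraicClasses`,
`ofRatClass`, `HodgeConjectureFor`, `Barriers.HodgeConjecture.HasChowZeroSupportedInDimLE`, `IsFano`; the tree's `BettiUniverse.hodgeConjectureFor_tensor_of_kunneth_pieces_pos_le`,
`BettiUniverse.ofRatClass_crossMap_mem_algebraicClasses_of_supportedClasses_eq_top`, `…_of_hodgeClasses_eq_top_left/right`, `supportedClasses_zero`, `supportedClasses_eq_top_of_hasChowZeroSupportedInDimLE_of_lt`,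
`hodgeNumber_eq_zero_of_supportedClasses_eq_top`, `hodgeConjectureFor_four_of_hasChowZeroSupportedInDimLE`, `BettiUniverse.hodgeNumber_eq_zero_of_hasChowZeroSupportedInDimLE_of_lt`, the seat's g33-#2
`BettiUniverse.hodgeClasses_hodge_four_eq_top_iff`, `hodgeTensorFacts_holds`, `exists_isReal_hodgeModel_holds`, `IsSmoothProjective.tensor_holds`.

DEVIATIONS / SCOPE.  Complex orientations.  §1 keeps `[HodgeTensorFacts.{0,0}]`, `hHD`, `HC(F)`, `HC(F')` and an arbitrary smooth projective structure on the product; §2 discharges them.  No definitions.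

## References
* [BlochSrinivas1983] S. Bloch, V. Srinivas, Remarks on correspondences and algebraic cycles, Amer. J. Math. 105 (1983) — Thm. 1.
* [VoisinHodgeII2003] C. Voisin, *Hodge Theory and Complex Algebraic Geometry II* (2003) — §10.2.2 Thm. 10.17, Cor. 10.18, Cor. 10.21; §10.2.3 Prop. 10.26.
* [Voisin2013GHCBloch] C. Voisin, The generalized Hodge and Bloch conjectures are equivalent for general complete intersections (2013) — Lemma 2.1.
* [ConteMurre1978] A. Conte, J. P. Murre, The Hodge conjecture for fourfolds admitting a covering by rational curves, Math. Ann. 238 (1978) — Thm. 1.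
* [VoisinHodgeI2002] C. Voisin, *Hodge Theory and Complex Algebraic Geometry I* (2002) — §7.1.1; §11.3.1 Thm. 11.30; §11.3.3 Thm. 11.38–11.40, Lemma 11.41, pp. 285–287.
* [KollarMiyaokaMori1992] J. Kollár, Y. Miyaoka, S. Mori, Rational connectedness and boundedness of Fano manifolds (1992) — Thm. 3.3.
* [Deligne2000] P. Deligne, *The Hodge conjecture* (Clay problem description) — §1.

## Provenance
Lane `lit-hodgefound` (Hodge path, Track 2), prover seat `lit-hodgefound-p29` (generation 33), self-proposed row g33-#6 (the `F × F'` case left open by g33-#5).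
-/

noncomputable section

open scoped TensorProduct
open CategoryTheory MonoidalCategory CartesianMonoidalCategory Module Finset
open Literature.AlgebraicTopology.SingularHomology
open Literature.Geometry.Kaehler
open Literature.Barriers.HodgeConjecture

namespace Literature.AlgebraicGeometry.HodgeTheory

open Literature.AlgebraicGeometry.Motives
open Literature.AlgebraicGeometry.Motives.HodgeStructure

variable {n d : ℕ} {X F F' : SchemeOver ℂ}

section Hodge

variable [HodgeTensorFacts.{0, 0}]

/-! ### §1 Two fourfolds: coniveau on the odd pieces, a pure algebraic factor on the even ones -/

/-- **`HC(F × F')` for smooth projective fourfolds with `HC(F)`, `HC(F')`, `N¹H³(F) = H³(F)`, `N¹H³(F') = H³(F')`, `h^{2,0}(F)·h^{2,0}(F') = 0`, [`h^{2,0}(F) = 0` or `Hdg²(H⁴F') = H⁴(F';ℚ)`],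
[`Hdg²(H⁴F) = H⁴(F;ℚ)` or `h^{2,0}(F') = 0`] and [`Hdg²(H⁴F) = ⊤` or `Hdg²(H⁴F') = ⊤`]**: the seven reduced Künneth pieces `H¹⊗H'³`, `H²⊗H'²`, `H³⊗H'¹`, `H²⊗H'⁴`, `H³⊗H'³`, `H⁴⊗H'²`, `H⁴⊗H'⁴` are, in
turn, of coniveau `≥ 1 = c − 1`, with a factor of divisor classes, of coniveau `≥ 1`, with a factor of Hodge (= algebraic) classes, of coniveau `≥ 2 = c − 1`, with a factor of Hodge classes (twice).
[cite: Voisin2013GHCBloch, Lemma 2.1 (proof)] [cite: VoisinHodgeI2002, §7.1.1, §11.3.3 Thm. 11.38–11.40, Lemma 11.41 and pp. 285–287, §11.3.1 Thm. 11.30] [cite: VoisinHodgeII2003, §9.2.4 Prop. 9.20] [cite: Deligne2000, §1] -/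
theorem BettiUniverse.hodgeConjectureFor_tensor_fourfolds_of_supportedClasses_three_eq_top (hHD : exists_isReal_hodgeModel) (hF : IsSmoothProjective 4 F) (hF' : IsSmoothProjective 4 F')
    (hFF' : IsSmoothProjective d (F ⊗ F')) (hHCF : HodgeConjectureFor 4 F) (hHCF' : HodgeConjectureFor 4 F') (hF3 : supportedClasses F 3 1 = ⊤) (hF3' : supportedClasses F' 3 1 = ⊤)
    (h22 : (BettiUniverse.hodge hHD hF 2).hodgeNumber 2 0 * (BettiUniverse.hodge hHD hF' 2).hodgeNumber 2 0 = 0)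
    (h24 : (BettiUniverse.hodge hHD hF 2).hodgeNumber 2 0 = 0 ∨ (BettiUniverse.hodge hHD hF' 4).hodgeClasses 2 = ⊤)
    (h42 : (BettiUniverse.hodge hHD hF 4).hodgeClasses 2 = ⊤ ∨ (BettiUniverse.hodge hHD hF' 2).hodgeNumber 2 0 = 0)
    (h44 : (BettiUniverse.hodge hHD hF 4).hodgeClasses 2 = ⊤ ∨ (BettiUniverse.hodge hHD hF' 4).hodgeClasses 2 = ⊤) : HodgeConjectureFor d (F ⊗ F') := by
  have halgF : ∀ (p : ℕ), ∀ z ∈ (BettiUniverse.hodge hHD hF (2 * p)).hodgeClasses (p : ℤ), ofRatClass (ComplexPoints F) (2 * p) z ∈ algebraicClasses F p :=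
    fun p z hz ↦ hHCF.2 p _ (isRationalClass_ofRatClass _) ((BettiUniverse.mem_hodgeClasses_hodge_iff_isOfHodgeType hHD hF p z).1 hz)
  have halgF' : ∀ (p : ℕ), ∀ z ∈ (BettiUniverse.hodge hHD hF' (2 * p)).hodgeClasses (p : ℤ), ofRatClass (ComplexPoints F') (2 * p) z ∈ algebraicClasses F' p :=
    fun p z hz ↦ hHCF'.2 p _ (isRationalClass_ofRatClass _) ((BettiUniverse.mem_hodgeClasses_hodge_iff_isOfHodgeType hHD hF' p z).1 hz)
  -- the even-piece mechanism: a factor all of whose rational classes are Hodge classes, hence algebraic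
  have evenL : ∀ (a b c : ℕ) (hc : 2 * a + 2 * b = 2 * c), (BettiUniverse.hodge hHD hF (2 * a)).hodgeClasses (a : ℤ) = ⊤ →
      ∀ t ∈ (BettiUniverse.kunnethSummand hHD hF hF' (2 * c) ⟨(2 * a, 2 * b), HasAntidiagonal.mem_antidiagonal.2 hc⟩).hodgeClasses c,
        ofRatClass (ComplexPoints (F ⊗ F')) (2 * c) (BettiUniverse.crossMap F F' hc t) ∈ algebraicClasses (F ⊗ F') c :=
    fun a b c hc htop t ht ↦ BettiUniverse.ofRatClass_crossMap_mem_algebraicClasses_of_hodgeClasses_eq_top_left hHD hF hF' hc htop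
      (fun u ↦ halgF a u (by rw [htop]; exact Submodule.mem_top)) (halgF' b) ht
  have evenR : ∀ (a b c : ℕ) (hc : 2 * a + 2 * b = 2 * c), (BettiUniverse.hodge hHD hF' (2 * b)).hodgeClasses (b : ℤ) = ⊤ →
      ∀ t ∈ (BettiUniverse.kunnethSummand hHD hF hF' (2 * c) ⟨(2 * a, 2 * b), HasAntidiagonal.mem_antidiagonal.2 hc⟩).hodgeClasses c,
        ofRatClass (ComplexPoints (F ⊗ F')) (2 * c) (BettiUniverse.crossMap F F' hc t) ∈ algebraicClasses (F ⊗ F') c :=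
    fun a b c hc htop t ht ↦ BettiUniverse.ofRatClass_crossMap_mem_algebraicClasses_of_hodgeClasses_eq_top_right hHD hF hF' hc htop (halgF a)
      (fun w ↦ halgF' b w (by rw [htop]; exact Submodule.mem_top)) ht
  -- the hypotheses at the indices `2 * 1`, `2 * 2` of the piece lemmas
  have h2F : (BettiUniverse.hodge hHD hF 2).hodgeNumber 2 0 = 0 → (BettiUniverse.hodge hHD hF (2 * 1)).hodgeClasses ((1 : ℕ) : ℤ) = ⊤ :=
    fun h ↦ (BettiUniverse.hodgeClasses_hodge_two_eq_top_iff hHD hF).2 h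
  have h2F' : (BettiUniverse.hodge hHD hF' 2).hodgeNumber 2 0 = 0 → (BettiUniverse.hodge hHD hF' (2 * 1)).hodgeClasses ((1 : ℕ) : ℤ) = ⊤ :=
    fun h ↦ (BettiUniverse.hodgeClasses_hodge_two_eq_top_iff hHD hF').2 h
  have h4F : (BettiUniverse.hodge hHD hF 4).hodgeClasses 2 = ⊤ → (BettiUniverse.hodge hHD hF (2 * 2)).hodgeClasses ((2 : ℕ) : ℤ) = ⊤ := fun h ↦ h
  have h4F' : (BettiUniverse.hodge hHD hF' 4).hodgeClasses 2 = ⊤ → (BettiUniverse.hodge hHD hF' (2 * 2)).hodgeClasses ((2 : ℕ) : ℤ) = ⊤ := fun h ↦ h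
  refine BettiUniverse.hodgeConjectureFor_tensor_of_kunneth_pieces_pos_le hHD hF hF' hFF' hHCF hHCF' fun c i j hij hi1 hi hj1 hj hc2 t ht ↦ ?_
  have hcases : (c = 2 ∧ (i = 1 ∧ j = 3 ∨ i = 2 ∧ j = 2 ∨ i = 3 ∧ j = 1)) ∨ (c = 3 ∧ (i = 2 ∧ j = 4 ∨ i = 3 ∧ j = 3 ∨ i = 4 ∧ j = 2)) ∨ (c = 4 ∧ i = 4 ∧ j = 4) := by omega
  rcases hcases with ⟨rfl, ⟨rfl, rfl⟩ | ⟨rfl, rfl⟩ | ⟨rfl, rfl⟩⟩ | ⟨rfl, ⟨rfl, rfl⟩ | ⟨rfl, rfl⟩ | ⟨rfl, rfl⟩⟩ | ⟨rfl, rfl, rfl⟩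
  · -- `H¹ ⊗ H'³`
    exact BettiUniverse.ofRatClass_crossMap_mem_algebraicClasses_of_supportedClasses_eq_top hHD hF hF' hFF' (i := 1) (j := 3) (p := 1) (r := 0) (s := 1) (by norm_num) (by norm_num)
      (supportedClasses_zero F 1) hF3' ht
  · -- `H² ⊗ H'²`
    rcases mul_eq_zero.1 h22 with h | h
    · exact evenL 1 1 2 (by norm_num) (h2F h) t ht
    · exact evenR 1 1 2 (by norm_num) (h2F' h) t ht
  · -- `H³ ⊗ H'¹`
    exact BettiUniverse.ofRatClass_crossMap_mem_algebraicClasses_of_supportedClasses_eq_top hHD hF hF' hFF' (i := 3) (j := 1) (p := 1) (r := 1) (s := 0) (by norm_num) (by norm_num)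
      hF3 (supportedClasses_zero F' 1) ht
  · -- `H² ⊗ H'⁴`
    rcases h24 with h | h
    · exact evenL 1 2 3 (by norm_num) (h2F h) t ht
    · exact evenR 1 2 3 (by norm_num) (h4F' h) t ht
  · -- `H³ ⊗ H'³`
    exact BettiUniverse.ofRatClass_crossMap_mem_algebraicClasses_of_supportedClasses_eq_top hHD hF hF' hFF' (i := 3) (j := 3) (p := 2) (r := 1) (s := 1) (by norm_num) (by norm_num)
      hF3 hF3' ht
  · -- `H⁴ ⊗ H'²`
    rcases h42 with h | h
    · exact evenL 2 1 3 (by norm_num) (h4F h) t ht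
    · exact evenR 2 1 3 (by norm_num) (h2F' h) t ht
  · -- `H⁴ ⊗ H'⁴`
    rcases h44 with h | h
    · exact evenL 2 2 4 (by norm_num) (h4F h) t ht
    · exact evenR 2 2 4 (by norm_num) (h4F' h) t ht

end Hodge

/-! ### §2 `CH₀` supported on surfaces -/

/-- **`N¹H⁴(X) = H⁴(X) ⟹ h^{4,0}(H⁴(X)) = 0`** (a class supported on a divisor has no `(4,0)`-part; the tree's `hodgeNumber_eq_zero_of_supportedClasses_eq_top` gives `h^{0,4} = 0`, then Hodge symmetry).
[cite: GrothendieckTopology1969, §1, p. 300] [cite: VoisinHodgeII2003, §10.2.2 Cor. 10.21] [cite: VoisinHodgeI2002, §7.1.1] -/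
theorem BettiUniverse.hodgeNumber_four_zero_eq_zero_of_supportedClasses_four_one_eq_top (hHD : exists_isReal_hodgeModel) (hX : IsSmoothProjective n X) (h : supportedClasses X 4 1 = ⊤) :
    (BettiUniverse.hodge hHD hX 4).hodgeNumber 4 0 = 0 := by
  rw [BettiUniverse.hodgeNumber_hodge_symm hHD hX 4 (4 : ℤ) 0]
  exact_mod_cast hodgeNumber_eq_zero_of_supportedClasses_eq_top hHD hX h (p := 0) (q := 4) rfl (by norm_num)

/-- **`HC(F × F')` for every smooth projective fourfold `F` whose `CH₀` is supported on a surface and every smooth projective fourfold `F'` whose `CH₀` is supported on a surface and which has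
`h^{2,0}(F') = 0` and `h^{3,1}(F') = 0`** — no other hypothesis (Bloch–Srinivas: `HC(F)`, `HC(F')`, `N¹H³`, `N¹H⁴` on both; so `h^{4,0}(F') = 0` and `Hdg²(H⁴F') = H⁴(F';ℚ)` by the seat's g33-#2
`BettiUniverse.hodgeClasses_hodge_four_eq_top_iff`; the standing tensor facts and the real Hodge model are theorems of the tree). [cite: BlochSrinivas1983, Thm. 1] [cite: VoisinHodgeII2003, §10.2.2 Thm. 10.17, Cor. 10.21, §10.2.3 Prop. 10.26] [cite: ConteMurre1978, Thm. 1]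
[cite: Voisin2013GHCBloch, Lemma 2.1 (proof)] [cite: VoisinHodgeI2002, §11.3.3 Thm. 11.38, Lemma 11.41 and p. 287, §11.3.1 Thm. 11.30] [cite: Deligne2000, §1] -/
theorem hodgeConjectureFor_tensor_fourfolds_of_hasChowZeroSupportedInDimLE_two (hF : IsSmoothProjective 4 F) (hF' : IsSmoothProjective 4 F') (hW : HasChowZeroSupportedInDimLE F 2)
    (hW' : HasChowZeroSupportedInDimLE F' 2) (h20 : (BettiUniverse.hodge exists_isReal_hodgeModel_holds hF' 2).hodgeNumber 2 0 = 0)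
    (h31 : (BettiUniverse.hodge exists_isReal_hodgeModel_holds hF' 4).hodgeNumber 3 1 = 0) : HodgeConjectureFor (4 + 4) (F ⊗ F') := by
  haveI : HodgeTensorFacts.{0, 0} := hodgeTensorFacts_holds
  have h4' : (BettiUniverse.hodge exists_isReal_hodgeModel_holds hF' 4).hodgeClasses 2 = ⊤ :=
    (BettiUniverse.hodgeClasses_hodge_four_eq_top_iff exists_isReal_hodgeModel_holds hF').2
      ⟨BettiUniverse.hodgeNumber_four_zero_eq_zero_of_supportedClasses_four_one_eq_top exists_isReal_hodgeModel_holds hF'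
        (supportedClasses_eq_top_of_hasChowZeroSupportedInDimLE_of_lt hF' hW' (by norm_num)), h31⟩
  exact BettiUniverse.hodgeConjectureFor_tensor_fourfolds_of_supportedClasses_three_eq_top exists_isReal_hodgeModel_holds hF hF' (hF.tensor_holds hF')
    (hodgeConjectureFor_four_of_hasChowZeroSupportedInDimLE hF (by norm_num) hW) (hodgeConjectureFor_four_of_hasChowZeroSupportedInDimLE hF' (by norm_num) hW')
    (supportedClasses_eq_top_of_hasChowZeroSupportedInDimLE_of_lt hF hW (by norm_num)) (supportedClasses_eq_top_of_hasChowZeroSupportedInDimLE_of_lt hF' hW' (by norm_num))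
    (mul_eq_zero_of_right _ h20) (Or.inr h4') (Or.inr h20) (Or.inr h4')

/-- **`HC(F × F')` for `CH₀(F)` supported on a surface, `CH₀(F')` supported on a CURVE and `h^{3,1}(F') = 0`** (`h^{2,0}(F') = 0` is then automatic, Bloch–Srinivas). [cite: BlochSrinivas1983, Thm. 1]
[cite: VoisinHodgeII2003, §10.2.2 Thm. 10.17, Cor. 10.18, Cor. 10.21, §10.2.3 Prop. 10.26] [cite: Voisin2013GHCBloch, Lemma 2.1 (proof)] [cite: Deligne2000, §1] -/
theorem hodgeConjectureFor_tensor_fourfolds_of_hasChowZeroSupportedInDimLE_two_one (hF : IsSmoothProjective 4 F) (hF' : IsSmoothProjective 4 F') (hW : HasChowZeroSupportedInDimLE F 2)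
    (hW' : HasChowZeroSupportedInDimLE F' 1) (h31 : (BettiUniverse.hodge exists_isReal_hodgeModel_holds hF' 4).hodgeNumber 3 1 = 0) : HodgeConjectureFor (4 + 4) (F ⊗ F') :=
  hodgeConjectureFor_tensor_fourfolds_of_hasChowZeroSupportedInDimLE_two hF hF' hW (hW'.mono (by norm_num))
    (by simpa using (BettiUniverse.hodgeNumber_eq_zero_of_hasChowZeroSupportedInDimLE_of_lt exists_isReal_hodgeModel_holds hF' hW' (k := 2) (by norm_num)).2) h31

/-- **`HC(F × F')` for two FANO fourfolds with `h^{3,1}(F') = 0`, granted the printed fact `KollarMiyaokaMori1992_fano_rationallyChainConnected`** (both `CH₀ = ℤ`). [cite: KollarMiyaokaMori1992, Thm. 3.3]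
[cite: BlochSrinivas1983, Thm. 1] [cite: ConteMurre1978, Thm. 1] [cite: Voisin2013GHCBloch, Lemma 2.1 (proof)] [cite: Deligne2000, §1] -/
theorem hodgeConjectureFor_tensor_fourfolds_of_isFano (hKMM : KollarMiyaokaMori1992_fano_rationallyChainConnected) (hF : IsFano 4 F) (hF' : IsFano 4 F')
    (h31 : (BettiUniverse.hodge exists_isReal_hodgeModel_holds hF'.isSmoothProjective 4).hodgeNumber 3 1 = 0) : HodgeConjectureFor (4 + 4) (F ⊗ F') :=
  hodgeConjectureFor_tensor_fourfolds_of_hasChowZeroSupportedInDimLE_two_one hF.isSmoothProjective hF'.isSmoothProjective ((hKMM.hasChowZeroSupportedInDimLE_zero hF).mono (by norm_num))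
    ((hKMM.hasChowZeroSupportedInDimLE_zero hF').mono (by norm_num)) h31

/-- **`HC(F × F)` for the self-product of a smooth projective fourfold `F` with `CH₀` supported on a surface, `h^{2,0}(F) = 0` and `h^{3,1}(F) = 0`.** [cite: BlochSrinivas1983, Thm. 1] [cite: VoisinHodgeII2003, §10.2.2 Thm. 10.17, Cor. 10.21, §10.2.3 Prop. 10.26]
[cite: Voisin2013GHCBloch, Lemma 2.1 (proof)] [cite: Deligne2000, §1] -/
theorem hodgeConjectureFor_tensor_self_fourfold_of_hasChowZeroSupportedInDimLE_two (hF : IsSmoothProjective 4 F) (hW : HasChowZeroSupportedInDimLE F 2)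
    (h20 : (BettiUniverse.hodge exists_isReal_hodgeModel_holds hF 2).hodgeNumber 2 0 = 0) (h31 : (BettiUniverse.hodge exists_isReal_hodgeModel_holds hF 4).hodgeNumber 3 1 = 0) :
    HodgeConjectureFor (4 + 4) (F ⊗ F) :=
  hodgeConjectureFor_tensor_fourfolds_of_hasChowZeroSupportedInDimLE_two hF hF hW hW h20 h31

end Literature.AlgebraicGeometry.HodgeTheory

end
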